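import Literature.NumberTheory.LFunctions.MertensBoundSoundararajan
import Literature.NumberTheory.LFunctions.SoundararajanProp1
import Literature.NumberTheory.LFunctions.VTypicalOrdinates2008
import HarnessLib

/-!
# `M(x) ≪ √x exp((log x)^{1/2}(log log x)^{5/2+δ})` under RH (Soundararajan; Balazard–de Roton)

Topic `Literature/NumberTheory/LFunctions`. Everything here is PROVED. K. Soundararajan, *Partial sums
of the Möbius function*, J. reine angew. Math. 631 (2009), Theorem 1, in the refined form of
M. Balazard, A. de Roton, arXiv:0810.3587, Théorème 1: under the Riemann Hypothesis, for every `δ > 0`,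
`M(x) = Σ_{n≤x} μ(n) ≪ √x exp((log x)^{1/2}(log log x)^{5/2+δ})`.

`SoundContour.mertens_bound_of_engine` (`MertensBoundSoundararajan.lean`) proves this from RH and the
three engine statements of Soundararajan's method (Balazard–de Roton 2008, Props. 1, 18, 20, in the
packaged shapes `Prop1With`, `Prop18With`, `Prop20With`) taken as hypotheses; those three statements are
theorems under RH (`SoundTest.prop1With_of_RH`, `prop18With_of_RH'`, `prop20With_of_RH` — the
Weil-explicit-formula proof of Soundararajan's main lemma, the Beurling–Selberg/Goldston–Gonek counts of
zeros in short intervals and the Maier–Montgomery-type moment bound). Hence the bound holds under RH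
alone: `mertens_bound_of_RH`, which is hypothesis `hA` of `BalazardDeRoton2010_thm1_of_deep`.

## References

* K. Soundararajan, Partial sums of the Möbius function, J. reine angew. Math. 631 (2009), Thm. 1.
* [BalazardDeRoton2008] M. Balazard, A. de Roton, arXiv:0810.3587, Théorème 1. [cite: BalazardDeRoton2008, Théorème 1]
* [BalazardDeRoton2010] M. Balazard, A. de Roton, arXiv:0812.1689, §6.1 (input (A)).
-/

noncomputable section

namespace Literature.NumberTheory.LFunctions

open BalazardDeRoton BaezDuarteOnlyIf

/-- **Soundararajan 2009, Thm. 1 / Balazard–de Roton 2008, Théorème 1, under RH:** for every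
`0 < δ ≤ ½` there is `C > 0` with `|M(x)| ≤ C √x exp((log x)^{1/2}(log log x)^{5/2+δ})` for all `x ≥ 3`
(`gFun p x = exp((log x)^{1/2}(log log x)^p)`). This is hypothesis `hA` of
`BalazardDeRoton2010_thm1_of_deep`. [cite: BalazardDeRoton2008, Théorème 1] -/
theorem mertens_bound_of_RH (hRH : RiemannHypothesis) :
    ∀ δ : ℝ, 0 < δ → δ ≤ 1 / 2 → ∃ C : ℝ, 0 < C ∧ ∀ x : ℝ, 3 ≤ x →
      |(mertensFunction x : ℝ)| ≤ C * Real.sqrt x * gFun (5 / 2 + δ) x :=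
  SoundContour.mertens_bound_of_engine hRH
    (fun δ hδ0 hδ1 ↦ by
      obtain ⟨D, T₀, -, h⟩ := SoundTest.prop1With_of_RH hRH hδ0 hδ1
      exact ⟨D, T₀, h⟩)
    (fun δ hδ0 hδ1 ↦ prop18With_of_RH' hRH hδ0 hδ1)
    (fun δ hδ0 hδ1 ↦ by
      obtain ⟨T₀, h⟩ := prop20With_of_RH hRH hδ0 hδ1
      exact ⟨1, 12, T₀, h⟩)

end Literature.NumberTheory.LFunctions
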